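import Literature.NumberTheory.EllipticCurves.OrdinaryReductionPinnedReductionMapProofs
import Literature.NumberTheory.EllipticCurves.TateModuleFixedPointsProofs
import HarnessLib

/-!
# The kernel of reduction `C_v ⊂ E[p^∞]` at a good ordinary place `v ∣ p`, II: its Tate module
# `T_p(C_v) = ker T_p(red)` and "`ψ = χ` on inertia" (Greenberg, LNM 1716, §2, p. 76) — PROVED

`Proofs` file (theorems only: no definition, no named fact, no instance, no `sorry`), topic
`NumberTheory/EllipticCurves`; sequel of `OrdinaryReductionPinnedReductionMapProofs` (the pinned
reduction map `f : E(K̄) → MO~(k_w)` at a good ordinary `v ∣ p`, with `ker f = ι⁻¹ E₁(K̄_v)`,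
`Γ_{K_v}`-stable, inertia-invariant, and the counts `2, 1`, onto).  It discharges the FIRST named
fact of `OrdinaryReductionTorsionCharacters`:

* `ordinaryReduction_inertia_smul_of_mem_kernelReduction_holds` — **F4a (Greenberg LNM 1716 §2
  p. 76: "`ψ` and `χ` become equal after restriction to the inertia subgroup")**: at a place
  `v ∣ p` of good ordinary reduction, `τ ∈ I_{K_v}` acts on every `P ∈ E(K̄)` with `p^k P = 0`
  and `ι P ∈ E₁(K̄_v)` as the scalar `χ_p(τ) mod p^k`.

via the Tate module `N = ker T_p f` of the kernel of reduction:

* `ker_baseChange_reductionMap_line` — Greenberg's line `F¹ = ker V_p(f) = N ⊗ ℚ_p` for the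
  PINNED `f`: a `Γ_{K_v}`-stable `ℚ_p`-line on which `I_{K_v}` acts through `χ_p` and modulo
  which it acts trivially (Step 7 of Part II of `OrdinaryReductionTateModuleProofs` verbatim:
  `RationalTateModule.finrank_ker_baseChange_map`, `…_mem_ker_of_ker_stable`, `…_sub_mem_ker`,
  `LinearMap.eq_det_smul_of_mem_of_finrank_eq_one`, `det ρ = χ_p`);
* `smul_eq_cyclotomicCharacter_smul_of_mem_ker_map` — **`τ x = χ_p(τ) x` for `x ∈ N`,
  `τ ∈ I_{K_v}`**, pulled back along `T_pE ↪ V_pE` (`TateModule.toRational_injective`);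
* `exists_mem_ker_map_proj_eq` — **the lift `N ↠ (ker f)[p^k]`**: `N = T_p(ker f)`
  (`TateModule.range_map_ker_subtype`), `#(ker f)[pⁿ] = pⁿ` (`TateModule.card_ker_torsionBy_pow`),
  so the projections are onto (`TateModule.proj_surjective_of_card`);
* F4a: lift `P`, read `τ x = χ_p(τ) x` at level `k` (`TateModule.proj_smul`,
  `proj_smul_of_distribMulAction`).

The second fact (the unramified character `φ`) is `OrdinaryReductionUnramifiedCharacterProofs`.

## References

* [GreenbergLNM1716] R. Greenberg, LNM 1716 (1999), §2, pp. 70–71 (`C_v ≅ ℚ_p/ℤ_p`), p. 76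
  (`ψ|_I = χ|_I`); held copy chunks p0073, p0079.
* [Greenberg1991] R. Greenberg, *Iwasawa theory for motives*, LMS LNS 153 (1991), §2, p. 214.
* [SerreInventiones1972] J.-P. Serre, Invent. Math. 15 (1972), §1.11 Prop. 11 and Cor.
* [SilvermanAEC2009] J. H. Silverman, *AEC* 2nd ed., III.7, III.8.3.

## Design

No definitions; the pinned data `(φ, hΔO, hX, f, hf)` and `hpv, hgood, hord` are section
hypotheses, instantiated in the final proof by `exists_pinnedSetup` and `rfl`.
`noncomputable section`, `open scoped Classical`.
-/

noncomputable section

open scoped Classical NNReal NumberField TensorProduct AddSubgroup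
open NumberField IsDedekindDomain Polynomial

namespace Literature.NumberTheory.EllipticCurves

open _root_.WeierstrassCurve Literature.NumberTheory.GaloisRepresentations Field
  IsDedekindDomain.HeightOneSpectrum

/-! ## The Tate module `N = ker T_p f` of the kernel of reduction -/

section TateLevel

variable {K : Type} [Field K] [NumberField K] {W : WeierstrassCurve K} [W.IsElliptic]
  {p : ℕ} [hp : Fact p.Prime] {v : HeightOneSpectrum (𝓞 K)}
  {φ : v.adicCompletionIntegers K →+* (v.spectralValuation).valuationSubring}
  (hΔO : IsUnit ((W.localMinimalIntegralModel v).map φ).Δ)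
  (hX : ((W.localMinimalIntegralModel v).map
      (algebraMap (v.adicCompletionIntegers K) (v.adicCompletion K))).baseChange
        (AlgebraicClosure (v.adicCompletion K)) =
      ((W.localMinimalIntegralModel v).map φ).baseChange (AlgebraicClosure (v.adicCompletion K)))
  (f : geomPoints W →+
    (((W.localMinimalIntegralModel v).map φ).map
      (IsLocalRing.residue (v.spectralValuation).valuationSubring)).toAffine.Point)
  (hf : ∀ a, f a = goodReductionHom ((W.localMinimalIntegralModel v).map φ)
    (Valuation.valuationSubring.integers v.spectralValuation) hΔO
    (Affine.Point.congrEquiv hX (W.localPointsEquivModel v (pointsMap W (v.adicCompletion K) a))))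
  (hpv : (p : 𝓞 K) ∈ v.asIdeal) (hgood : W.HasGoodReductionAt v)
  (hord : ¬ ((p : ℤ) ∣ W.frobeniusTraceAt v))

include hf hpv hgood hord

/-- **Greenberg's line `F¹ = ker V_p(f)`**, pinned: it is a `ℚ_p`-line, `Γ_{K_v}`-stable, on which
the inertia group acts through `χ_p` and modulo which it acts trivially (Steps 7 and "by `𝒩¹` on
`gr¹`" of Part II of `OrdinaryReductionTateModuleProofs`, VERBATIM for the pinned `f`; Greenberg
1991 §2 p. 214: "since the determinant of the Galois action on `T_p(E)` is `𝒩`",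
`det_rationalTateRepresentation_eq_cyclotomicCharacter`).
[cite: Greenberg1991, §2 (p. 214)] [cite: SilvermanAEC2009, Prop. III.8.3] -/
theorem ker_baseChange_reductionMap_line :
    Module.finrank ℚ_[p] (LinearMap.ker ((TateModule.map p f).baseChange ℚ_[p])) = 1 ∧
      (∀ (τ : absoluteGaloisGroup (v.adicCompletion K)),
        ∀ x ∈ LinearMap.ker ((TateModule.map p f).baseChange ℚ_[p]),
          W.rationalGaloisRepTate p (absGaloisRestrict K (v.adicCompletion K) τ) x ∈
            LinearMap.ker ((TateModule.map p f).baseChange ℚ_[p])) ∧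
      (∀ τ ∈ absInertia (v.adicCompletion K),
        ∀ x ∈ LinearMap.ker ((TateModule.map p f).baseChange ℚ_[p]),
          W.rationalGaloisRepTate p (absGaloisRestrict K (v.adicCompletion K) τ) x =
            (((GaloisRep.cyclotomicCharacter (v.adicCompletion K) p τ : ℤ_[p]ˣ) : ℤ_[p]) :
              ℚ_[p]) • x) ∧
      (∀ τ ∈ absInertia (v.adicCompletion K), ∀ x : W.rationalTateModule p,
        W.rationalGaloisRepTate p (absGaloisRestrict K (v.adicCompletion K) τ) x - x ∈
          LinearMap.ker ((TateModule.map p f).baseChange ℚ_[p])) := by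
  obtain ⟨hstab, hinv, hA, hB, hsurj⟩ :=
    reductionMap_stable_invariant_counts hΔO hX f hf hpv hgood hord
  set Lk : Submodule ℚ_[p] (W.rationalTateModule p) :=
    LinearMap.ker ((TateModule.map p f).baseChange ℚ_[p]) with hLk
  have h1 : Module.finrank ℚ_[p] Lk = 1 :=
    RationalTateModule.finrank_ker_baseChange_map (f := f) hA hB hsurj
  have h2 : ∀ (τ : absoluteGaloisGroup (v.adicCompletion K)), ∀ x ∈ Lk,
      W.rationalGaloisRepTate p (absGaloisRestrict K (v.adicCompletion K) τ) x ∈ Lk :=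
    fun τ x hx ↦ RationalTateModule.baseChange_tateRepresentation_mem_ker_of_ker_stable f
      (absGaloisRestrict K (v.adicCompletion K) τ) (hstab τ) hx
  have h4 : ∀ τ ∈ absInertia (v.adicCompletion K), ∀ x : W.rationalTateModule p,
      W.rationalGaloisRepTate p (absGaloisRestrict K (v.adicCompletion K) τ) x - x ∈ Lk :=
    fun τ hτ x ↦ RationalTateModule.baseChange_tateRepresentation_sub_mem_ker f
      (absGaloisRestrict K (v.adicCompletion K) τ) (hinv τ hτ) x
  haveI : Module.Finite ℚ_[p] (W.rationalTateModule p) :=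
    module_finite_rationalTateModule_holds W p
  haveI : NeZero (p : K) := ⟨Nat.cast_ne_zero.mpr hp.out.ne_zero⟩
  have h3 : ∀ τ ∈ absInertia (v.adicCompletion K), ∀ x ∈ Lk,
      W.rationalGaloisRepTate p (absGaloisRestrict K (v.adicCompletion K) τ) x =
        (((GaloisRep.cyclotomicCharacter (v.adicCompletion K) p τ : ℤ_[p]ˣ) : ℤ_[p]) :
          ℚ_[p]) • x := by
    intro τ hτ x hx
    have hdet : LinearMap.det
        (W.rationalGaloisRepTate p (absGaloisRestrict K (v.adicCompletion K) τ) :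
          W.rationalTateModule p →ₗ[ℚ_[p]] W.rationalTateModule p) =
        (((GaloisRep.cyclotomicCharacter K p (absGaloisRestrict K (v.adicCompletion K) τ) :
          ℤ_[p]ˣ) : ℤ_[p]) : ℚ_[p]) :=
      det_rationalTateRepresentation_eq_cyclotomicCharacter W p _
    rw [LinearMap.eq_det_smul_of_mem_of_finrank_eq_one Lk h1 _ (h2 τ) (h4 τ hτ) x hx, hdet,
      cyclotomicCharacter_absGaloisRestrict]
  exact ⟨h1, h2, h3, h4⟩

/-- **"`ψ` and `χ` become equal after restriction to the inertia subgroup", on the Tate module**: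
an element `τ` of `I_{K_v}` acts on `N = ker T_p f = T_p(C_v)` as the scalar `χ_p(τ) ∈ ℤ_p`
(Greenberg's determinant step on `F¹ = N ⊗ ℚ_p`, pulled back along the injection `T_pE ↪ V_pE`,
`TateModule.toRational_injective`).  Greenberg LNM 1716 §2 p. 76; Greenberg 1991 §2.
[cite: GreenbergLNM1716, §2 p. 76 (held copy p0079)] [cite: Greenberg1991, §2 (p. 214)] -/
theorem smul_eq_cyclotomicCharacter_smul_of_mem_ker_map
    {τ : absoluteGaloisGroup (v.adicCompletion K)} (hτ : τ ∈ absInertia (v.adicCompletion K))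
    {x : W.tateModule p} (hx : x ∈ LinearMap.ker (TateModule.map p f)) :
    absGaloisRestrict K (v.adicCompletion K) τ • x =
      ((GaloisRep.cyclotomicCharacter (v.adicCompletion K) p τ : ℤ_[p]ˣ) : ℤ_[p]) • x := by
  obtain ⟨-, -, h3, -⟩ := ker_baseChange_reductionMap_line hΔO hX f hf hpv hgood hord
  have hxL : ((1 : ℚ_[p]) ⊗ₜ[ℤ_[p]] x : ℚ_[p] ⊗[ℤ_[p]] W.tateModule p) ∈
      LinearMap.ker ((TateModule.map p f).baseChange ℚ_[p]) := by
    rw [LinearMap.mem_ker, LinearMap.baseChange_tmul, LinearMap.mem_ker.mp hx,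
      TensorProduct.tmul_zero]
  apply TateModule.toRational_injective (A := geomPoints W) (p := p)
  rw [← rationalTateRepresentation_toRational, LinearMap.map_smul,
    ← algebraMap_smul ℚ_[p]
      ((GaloisRep.cyclotomicCharacter (v.adicCompletion K) p τ : ℤ_[p]ˣ) : ℤ_[p])]
  exact h3 τ hτ _ hxL

/-- **The lift `T_p(C_v) ↠ C_v[p^k]`**: every `p^k`-torsion point `P ∈ E(K̄)` with `f P = 0` is
the `k`-th component of an element of `N = ker T_p f` — `N = T_p(ker f)`
(`TateModule.range_map_ker_subtype`) and `#(ker f)[pⁿ] = pⁿ` for all `n`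
(`TateModule.card_ker_torsionBy_pow`: ranks `2, 1`, hence `1`), so the projections of
`T_p(ker f)` are onto (`TateModule.proj_surjective_of_card`).  Greenberg LNM 1716 §2
pp. 70–71 ("`C_v ≅ ℚ_p/ℤ_p`"). [cite: GreenbergLNM1716, §2 pp. 70–71 (held copy p0073)] -/
theorem exists_mem_ker_map_proj_eq (k : ℕ) {P : geomPoints W}
    (hP : P ∈ (geomPoints W)[(p ^ k : ℕ)]) (hP0 : f P = 0) :
    ∃ x ∈ LinearMap.ker (TateModule.map p f), TateModule.proj p k x = P := by
  obtain ⟨-, -, hA, hB, hsurj⟩ :=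
    reductionMap_stable_invariant_counts hΔO hX f hf hpv hgood hord
  have hC : ∀ n, Nat.card ((f.ker)[(p ^ n : ℕ)]) = p ^ (1 * n) := fun n ↦ by
    rw [TateModule.card_ker_torsionBy_pow hA hB hsurj n]
  have hP' : (⟨P, (AddMonoidHom.mem_ker).mpr hP0⟩ : f.ker) ∈ (f.ker)[(p ^ k : ℕ)] :=
    AddSubgroup.torsionBy.nsmul_iff.mpr (Subtype.ext (AddSubgroup.torsionBy.nsmul_iff.mp hP))
  obtain ⟨a, ha⟩ := TateModule.proj_surjective_of_card hC k hP'
  refine ⟨TateModule.map p f.ker.subtype a, ?_, ?_⟩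
  · rw [← TateModule.range_map_ker_subtype]
    exact LinearMap.mem_range_self _ a
  · rw [TateModule.proj_map, ha]
    rfl

end TateLevel

/-! ## F4a: inertia acts on `C_v[p^k]` through `χ_p` -/

/-- **Greenberg, LNM 1716 §2 (p. 76), PROVED: on the kernel of reduction `C_v = Ê[p^∞]` at a
place `v ∣ p` of good ORDINARY reduction, "`ψ` and `χ` become equal after restriction to the
inertia subgroup"** — discharge of the named fact
`Literature.NumberTheory.EllipticCurves.ordinaryReduction_inertia_smul_of_mem_kernelReduction`:
for `τ ∈ I_{K_v}` and `P ∈ E(K̄)` with `p^k P = 0` and `ι P ∈ E₁(K̄_v)`,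
`τ • P = (χ_p(τ) mod p^k) • P`.  Proof: `P ∈ (ker f)[p^k]` for the pinned reduction map `f`
(`reductionMap_eq_zero_iff_mem_localKernelOfReduction`); lift `P` to `x ∈ N = ker T_p f`
(`exists_mem_ker_map_proj_eq`); there `τ x = χ_p(τ) x`
(`smul_eq_cyclotomicCharacter_smul_of_mem_ker_map`); read the `k`-th component
(`TateModule.proj_smul`).  Serre 1972 §1.11 Prop. 11 is the level-`p` case.
[cite: GreenbergLNM1716, §2 p. 76 (held copy p0079: "ψ and χ become equal after restriction to the inertia subgroup"); §2 pp. 70–71 (p0073)]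
[cite: SerreInventiones1972, §1.11 Prop. 11 and Cor.] [cite: Greenberg1991, §2 (p. 214)] -/
theorem ordinaryReduction_inertia_smul_of_mem_kernelReduction_holds :
    ordinaryReduction_inertia_smul_of_mem_kernelReduction := by
  intro K _ _ W _ p _ v hpv hgood hord τ hτ k P hP hmem
  -- the pinned setup and its reduction map `f`
  obtain ⟨φ, -, hΔO, hX⟩ := exists_pinnedSetup W v hgood
  have hvO : (v.spectralValuation).Integers (v.spectralValuation).valuationSubring :=
    Valuation.valuationSubring.integers _
  set f : geomPoints W →+ (((W.localMinimalIntegralModel v).map φ).map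
      (IsLocalRing.residue (v.spectralValuation).valuationSubring)).toAffine.Point :=
    (goodReductionHom ((W.localMinimalIntegralModel v).map φ) hvO hΔO).comp
      (((Affine.Point.congrEquiv hX).toAddMonoidHom.comp
        (W.localPointsEquivModel v).toAddMonoidHom).comp (pointsMap W (v.adicCompletion K)))
    with hfdef
  have hf : ∀ a, f a = goodReductionHom ((W.localMinimalIntegralModel v).map φ) hvO hΔO
      (Affine.Point.congrEquiv hX (W.localPointsEquivModel v (pointsMap W (v.adicCompletion K) a))) :=
    fun _ ↦ rfl
  -- `P ∈ C_v[p^k]`, lifted to `N`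
  have hP0 : f P = 0 :=
    (reductionMap_eq_zero_iff_mem_localKernelOfReduction W v hΔO hX f hf P).mpr hmem
  have hPk : P ∈ (geomPoints W)[(p ^ k : ℕ)] := AddSubgroup.torsionBy.nsmul_iff.mpr hP
  obtain ⟨x, hxN, hxP⟩ := exists_mem_ker_map_proj_eq hΔO hX f hf hpv hgood hord k hPk hP0
  have hτx := smul_eq_cyclotomicCharacter_smul_of_mem_ker_map hΔO hX f hf hpv hgood hord hτ hxN
  have h := congrArg (TateModule.proj p k) hτx
  rw [TateModule.proj_smul_of_distribMulAction, TateModule.proj_smul, hxP] at h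
  exact h

end Literature.NumberTheory.EllipticCurves

end
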